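import Summits.Langlands.Langlands.Theorems.SpreadDecayCarving

/-!
# `SpreadDecayCarvingKernel` — CENSUS TWIN, PART 2 of 2 of the lens-6 g31 node `SpreadDecayCarving` (decomp-langlands, barrier-complement carving)

Part 1 (`Summits.Langlands.Langlands.Theorems.SpreadDecayCarving`) holds the route-text copies SD `SpreadDecay`, DWε `DetWeightEpsilon`,
εPURE `EpsilonPurity`, the print seam TPN `TensorPowerNarrowing`, the named dials and the EQUIV-layer helpers.  This part holds, in the
SAME namespace: the first rungs in kernel (`hasSpreadDecay_of_projFinite`, `hasSpreadDecay_rankOne`, `isEpsilonPure_of_finiteOrder`,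
`isEpsilonPure_rankOne_of_fact` modulo the verbatim avatar `DeRhamCharacterHeckeAvatar` of the tree fact
`FramedGaloisRep.exists_heckeCharacter_of_isDeRhamFramed`), the kernel seam `closes_gww : DWε → SD → GWW`
(`Theorems.SatakeWindowCarving.GaloisWeightWindow` BY NAME), `epsilonPurity_iff_pieces : εPURE ↔ DWε ∧ SD`, `closes_host : … → B_w`
(stmt-Langlands-17414 BY NAME via `Theorems.SatakeWindowCarving.closes_child`), `closes_root : … → Langlands`, the necessity certificates
`detWeight_of_weakAut : B_w → DWε` (kernel) / `pieces_of_gww` (mod TPN) / `pieces_iff_target_modTPN`, and the BC5 rungs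
`projFiniteSpreadRung`, `finiteOrderPurityRung`, `rankOnePurityRung_of_fact`, `rankOneWindowRung_of_fact` with their S-cases
`ProjFiniteCase`, `ArtinCase`.  0 sorry; axioms ⊆ {propext, Classical.choice, Quot.sound} (guards in the node file). Supports stmt-Langlands-17414.
-/

set_option linter.dupNamespace false -- project-wide option (lakefile weak.linter.dupNamespace); `Summit.Langlands.Langlands` is the mandated namespace

namespace Summit.Langlands.Langlands.Theorems.SpreadDecayCarving

open Filter Polynomial
open scoped NumberField

section DialRungs

open IsDedekindDomain NumberField Literature.NumberTheory.GaloisRepresentations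

variable {K : Type} [Field K] [NumberField K] {ℓ : ℕ} [Fact ℓ.Prime]

/-! ### First rungs in kernel -/

/-- **SD for PROJECTIVELY FINITE `ρ`** (some power `ρ(σ)^k` is scalar for every `σ`; e.g. every twist of an Artin representation by
ANY character): every Frobenius root `β` has `β^k = c` for the same scalar `c`, so all roots at `v` have the SAME absolute value and the
spread is `1 ≤ q_v^ε`.  Spectrum algebra: `Matrix.mem_spectrum_of_isRoot_charpoly`, `spectrum.pow_mem_pow`, `spectrum.scalar_eq`.
[folklore] -/
theorem hasSpreadDecay_of_projFinite (ι : PadicAlgCl ℓ ≃+* ℂ) {n : ℕ} (ρ : FramedGaloisRep K (PadicAlgCl ℓ) n) {k : ℕ} (hk : 0 < k)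
    (hρ : ∀ σ : Field.absoluteGaloisGroup K, ∃ c : PadicAlgCl ℓ,
      ((ρ σ : GL (Fin n) (PadicAlgCl ℓ)) : Matrix (Fin n) (Fin n) (PadicAlgCl ℓ)) ^ k =
        algebraMap (PadicAlgCl ℓ) (Matrix (Fin n) (Fin n) (PadicAlgCl ℓ)) c) :
    HasSpreadDecay K ℓ ι ρ := by
  classical
  intro ε hε
  refine Filter.Eventually.of_forall fun v P hP β hβ β' hβ' => ?_
  obtain ⟨𝔓, h𝔓⟩ := v.primesAbove_nonempty
  obtain ⟨σ, hσ⟩ := HeightOneSpectrum.exists_isArithFrobAt_of_mem_primesAbove_holds h𝔓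
  set M : Matrix (Fin n) (Fin n) (PadicAlgCl ℓ) := ((ρ σ : GL (Fin n) (PadicAlgCl ℓ)) : Matrix (Fin n) (Fin n) (PadicAlgCl ℓ)) with hM
  have hPσ : P = M.charpoly := (hP 𝔓 h𝔓 σ hσ).symm
  obtain ⟨c, hc⟩ := hρ σ
  -- `n = 0`: no roots
  rcases Nat.eq_zero_or_pos n with hn0 | hnpos
  · exfalso
    subst hn0
    have h1 : M.charpoly = 1 := by unfold Matrix.charpoly; exact Matrix.det_isEmpty
    rw [hPσ, h1, Polynomial.roots_one] at hβ
    exact Multiset.notMem_zero _ hβ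
  haveI : Nonempty (Fin n) := ⟨⟨0, hnpos⟩⟩
  have key : ∀ γ ∈ P.roots, ‖ι γ‖ ^ k = ‖ι c‖ := by
    intro γ hγ
    have hroot : Polynomial.IsRoot M.charpoly γ := by rw [← hPσ]; exact Polynomial.isRoot_of_mem_roots hγ
    have hspec : γ ∈ spectrum (PadicAlgCl ℓ) M := Matrix.mem_spectrum_of_isRoot_charpoly hroot
    have hspeck : γ ^ k ∈ spectrum (PadicAlgCl ℓ) (M ^ k) := spectrum.pow_mem_pow M k hspec
    have hMk : M ^ k = algebraMap (PadicAlgCl ℓ) (Matrix (Fin n) (Fin n) (PadicAlgCl ℓ)) c := by rw [hM]; exact hc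
    rw [hMk, spectrum.scalar_eq, Set.mem_singleton_iff] at hspeck
    rw [← norm_pow, ← map_pow, hspeck]
  have heq : ‖ι β‖ = ‖ι β'‖ :=
    (pow_left_inj₀ (norm_nonneg _) (norm_nonneg _) hk.ne').1 (by rw [key β hβ, key β' hβ'])
  have hq1 : (1 : ℝ) ≤ v.residueCard := by exact_mod_cast v.one_lt_residueCard.le
  rw [heq]
  exact le_mul_of_one_le_left (norm_nonneg _) (Real.one_le_rpow hq1 hε.le)

/-- **SD at `n = 1` OUTRIGHT** (no fact needed): a rank-one Frobenius polynomial has ONE root, so the spread is `1 ≤ q_v^ε` — SD is blind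
to `GL₁` (and to every character twist). [folklore] -/
theorem hasSpreadDecay_rankOne (ι : PadicAlgCl ℓ ≃+* ℂ) (ρ : FramedGaloisRep K (PadicAlgCl ℓ) 1) : HasSpreadDecay K ℓ ι ρ := by
  intro ε hε
  refine Filter.Eventually.of_forall fun v P hP β hβ β' hβ' => ?_
  obtain ⟨a, ha⟩ := Multiset.card_eq_one.1 (card_roots_of_hasFrobCharpolyAt ρ hP)
  rw [ha, Multiset.mem_singleton] at hβ hβ'
  subst hβ; subst hβ'
  have hq1 : (1 : ℝ) ≤ v.residueCard := by exact_mod_cast v.one_lt_residueCard.le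
  exact le_mul_of_one_le_left (norm_nonneg _) (Real.one_le_rpow hq1 hε.le)

/-- finite order is projectively finite (`c = 1`). [folklore] -/
theorem hasSpreadDecay_of_finiteOrder (ι : PadicAlgCl ℓ ≃+* ℂ) {n : ℕ} (ρ : FramedGaloisRep K (PadicAlgCl ℓ) n) {k : ℕ} (hk : 0 < k)
    (hρ : ∀ σ : Field.absoluteGaloisGroup K, ρ σ ^ k = 1) : HasSpreadDecay K ℓ ι ρ :=
  hasSpreadDecay_of_projFinite ι ρ hk fun σ => ⟨1, by
    rw [← Units.val_pow_eq_pow_val, hρ σ, Units.val_one, map_one]⟩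

/-- **εPURE (w = 0) for FINITE-ORDER `ρ`**: every Frobenius root is a root of unity, `|ι β| = 1 ∈ [q^{-ε}, q^{ε}]`. [folklore] -/
theorem isEpsilonPure_of_finiteOrder (ι : PadicAlgCl ℓ ≃+* ℂ) {n : ℕ} (ρ : FramedGaloisRep K (PadicAlgCl ℓ) n) {k : ℕ} (hk : 0 < k)
    (hρ : ∀ σ : Field.absoluteGaloisGroup K, ρ σ ^ k = 1) : IsEpsilonPure K ℓ ι ρ := by
  classical
  refine ⟨0, fun ε hε => Filter.Eventually.of_forall fun v P hP β hβ => ?_⟩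
  obtain ⟨𝔓, h𝔓⟩ := v.primesAbove_nonempty
  obtain ⟨σ, hσ⟩ := HeightOneSpectrum.exists_isArithFrobAt_of_mem_primesAbove_holds h𝔓
  set M : Matrix (Fin n) (Fin n) (PadicAlgCl ℓ) := ((ρ σ : GL (Fin n) (PadicAlgCl ℓ)) : Matrix (Fin n) (Fin n) (PadicAlgCl ℓ)) with hM
  have hPσ : P = M.charpoly := (hP 𝔓 h𝔓 σ hσ).symm
  have hMk : M ^ k = 1 := by
    rw [hM, ← Units.val_pow_eq_pow_val, hρ σ, Units.val_one]
  rcases Nat.eq_zero_or_pos n with hn0 | hnpos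
  · exfalso
    subst hn0
    have h1 : M.charpoly = 1 := by unfold Matrix.charpoly; exact Matrix.det_isEmpty
    rw [hPσ, h1, Polynomial.roots_one] at hβ
    exact Multiset.notMem_zero _ hβ
  haveI : Nonempty (Fin n) := ⟨⟨0, hnpos⟩⟩
  have hroot : Polynomial.IsRoot M.charpoly β := by rw [← hPσ]; exact Polynomial.isRoot_of_mem_roots hβ
  have hspec : β ∈ spectrum (PadicAlgCl ℓ) M := Matrix.mem_spectrum_of_isRoot_charpoly hroot
  have hspeck : β ^ k ∈ spectrum (PadicAlgCl ℓ) (M ^ k) := spectrum.pow_mem_pow M k hspec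
  rw [hMk, spectrum.one_eq, Set.mem_singleton_iff] at hspeck
  have hn1 : ‖ι β‖ = 1 := by
    have h1 : ‖ι β‖ ^ k = 1 := by rw [← norm_pow, ← map_pow, hspeck, map_one, norm_one]
    exact (pow_eq_one_iff_of_nonneg (norm_nonneg _) hk.ne').1 h1
  have hq1 : (1 : ℝ) ≤ (v.residueCard : ℝ) := by exact_mod_cast v.one_lt_residueCard.le
  rw [hn1]
  constructor
  · exact Real.rpow_le_one_of_one_le_of_nonpos hq1 (by linarith)
  · exact Real.one_le_rpow hq1 (by linarith)

/-- node-local VERBATIM copy of the named Literature fact `FramedGaloisRep.exists_heckeCharacter_of_isDeRhamFramed`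
(`Literature/NumberTheory/GaloisRepresentations/DeRhamLAdicCharacterHecke.lean`, Patrikis 2019 Prop. 2.2.1 / Serre 1968 III §2.3: a de
Rham `ℓ`-adic character is the avatar of an ALGEBRAIC Hecke character) — restated here ONLY because that module is outside the farm's
built snapshot (lean check: `remote:stale:…:unbuilt:…DeRhamLAdicCharacterHecke`); the texts agree token for token, so
`Iff.rfl` bridges them once the module builds (the twin should then import it and cite the fact BY NAME). [conjecture] -/
def DeRhamCharacterHeckeAvatar : Prop :=
  ∀ (K : Type) [Field K] [NumberField K] (ℓ : ℕ) [Fact ℓ.Prime]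
    (ψ : FramedGaloisRep K (PadicAlgCl ℓ) 1),
    (∀ (v : HeightOneSpectrum (𝓞 K)) (hv : ((ℓ : ℕ) : 𝓞 K) ∈ v.asIdeal),
      (Literature.NumberTheory.PAdicHodge.fontainePstAdicCompletion v ℓ hv).IsDeRhamFramed (ψ.toLocal v)) →
    ∀ (ι : PadicAlgCl ℓ ≃+* ℂ), ∃ χ : HeckeCharacter K, χ.IsAlgebraic ∧
      ∀ᶠ v : HeightOneSpectrum (𝓞 K) in cofinite, χ.IsUnramifiedAt v ∧ ψ.IsUnramifiedAt v ∧
        ψ.HasFrobCharpolyAt v (X - C (ι.symm (χ.valueAtUniformizer v)⁻¹))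

/-- **εPURE at `n = 1` modulo ONE named tree fact** (`FramedGaloisRep.exists_heckeCharacter_of_isDeRhamFramed`: a de Rham `ℓ`-adic
character is the avatar of a type-A₀ Hecke character `χ`, Serre 1968 III / Patrikis 2019 Prop. 2.2.1): then the single Frobenius root
is `ι⁻¹(χ(ϖ_v)⁻¹)` and WEIL PURITY — PROVED in the tree, `HasInfinityType.exists_two_mul_add_eq_weight_mul_mult` +
`HasInfinityType.norm_valueAtUniformizer_sq`: `|χ(ϖ_v)|² = q_v^{wt}` off the module of definition — gives `|ι β| = q_v^{-wt/2}`
EXACTLY. [folklore] -/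
theorem isEpsilonPure_rankOne_of_fact (hF : DeRhamCharacterHeckeAvatar) (ι : PadicAlgCl ℓ ≃+* ℂ)
    (ρ : FramedGaloisRep K (PadicAlgCl ℓ) 1)
    (hdR : ∀ (v : HeightOneSpectrum (𝓞 K)) (hv : ((ℓ : ℕ) : 𝓞 K) ∈ v.asIdeal),
      (Literature.NumberTheory.PAdicHodge.fontainePstAdicCompletion v ℓ hv).IsDeRhamFramed (ρ.toLocal v)) :
    IsEpsilonPure K ℓ ι ρ := by
  classical
  obtain ⟨χ, hχalg, hχ⟩ := hF K ℓ ρ hdR ι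
  obtain ⟨p, q, hinf⟩ := (HeckeCharacter.isAlgebraic_iff_exists_hasInfinityType χ).1 hχalg
  obtain ⟨wt, hw⟩ := hinf.exists_two_mul_add_eq_weight_mul_mult
  obtain ⟨T, e, hmod⟩ := HeckeCharacter.exists_isModulus χ
  refine ⟨-(wt : ℝ), fun ε hε => ?_⟩
  filter_upwards [hχ, T.eventually_cofinite_notMem] with v hv hvT P hP β hβ
  obtain ⟨-, -, hFrob⟩ := hv
  obtain ⟨𝔓, h𝔓⟩ := v.primesAbove_nonempty
  obtain ⟨σ, hσ⟩ := HeightOneSpectrum.exists_isArithFrobAt_of_mem_primesAbove_holds h𝔓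
  have hPeq : P = X - C (ι.symm (χ.valueAtUniformizer v)⁻¹) := (hP 𝔓 h𝔓 σ hσ).symm.trans (hFrob 𝔓 h𝔓 σ hσ)
  rw [hPeq, Polynomial.roots_X_sub_C, Multiset.mem_singleton] at hβ
  subst hβ
  have hsq := hinf.norm_valueAtUniformizer_sq hmod hw hvT
  have hq1 : (1 : ℝ) < v.residueCard := by exact_mod_cast v.one_lt_residueCard
  have hq0 : (0 : ℝ) < v.residueCard := zero_lt_one.trans hq1
  have hqdef : ((Ideal.absNorm v.asIdeal : ℕ) : ℝ) = (v.residueCard : ℝ) := rfl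
  have hnorm : ‖χ.valueAtUniformizer v‖ = (v.residueCard : ℝ) ^ ((wt : ℝ) / 2) := by
    have h1 : (‖χ.valueAtUniformizer v‖ ^ 2) ^ ((2 : ℝ)⁻¹) = ‖χ.valueAtUniformizer v‖ :=
      Real.pow_rpow_inv_natCast (norm_nonneg _) two_ne_zero
    rw [← h1, hsq, hqdef, ← Real.rpow_intCast, ← Real.rpow_mul hq0.le]
    congr 1
  have hβnorm : ‖ι (ι.symm (χ.valueAtUniformizer v)⁻¹)‖ = (v.residueCard : ℝ) ^ (-(wt : ℝ) / 2) := by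
    rw [RingEquiv.apply_symm_apply, norm_inv, hnorm, ← Real.rpow_neg hq0.le]; congr 1; ring
  rw [hβnorm]
  constructor
  · exact Real.rpow_le_rpow_of_exponent_le hq1.le (by linarith)
  · exact Real.rpow_le_rpow_of_exponent_le hq1.le (by linarith)

end DialRungs

/-! ## Kernel: route texts ↔ named dials; EXACTNESS of the EQUIV layer; `closes_gww` -/

section Kernel

open IsDedekindDomain NumberField Literature.NumberTheory.Automorphic Literature.NumberTheory.GaloisRepresentations

/-- SD IS the named dial under the GWW binders (definitional). [folklore] -/
theorem spreadDecay_iff_named : SpreadDecay ↔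
    (∀ (K : Type) [Field K] [NumberField K] (n : ℕ), 0 < n → ∀ (ℓ : ℕ) [Fact ℓ.Prime] (ι : PadicAlgCl ℓ ≃+* ℂ)
      (ρ : FramedGaloisRep K (PadicAlgCl ℓ) n), ρ.toGaloisRep.IsIrreducible →
      ((∀ᶠ v : IsDedekindDomain.HeightOneSpectrum (NumberField.RingOfIntegers K) in cofinite, ρ.IsUnramifiedAt v) ∧ ∀ (v : IsDedekindDomain.HeightOneSpectrum (NumberField.RingOfIntegers K)) (hv : ((ℓ : ℕ) : NumberField.RingOfIntegers K) ∈ v.asIdeal), (Literature.NumberTheory.PAdicHodge.fontainePstAdicCompletion v ℓ hv).IsDeRhamFramed (ρ.toLocal v)) →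
      HasSpreadDecay K ℓ ι ρ) :=
  ⟨fun h K _ _ n hn ℓ _ ι ρ hirr hgeo => h K n hn ℓ ι ρ hirr hgeo, fun h K _ _ n hn ℓ _ ι ρ hirr hgeo => h K n hn ℓ ι ρ hirr hgeo⟩

/-- DWε IS the named dial under the GWW binders (definitional). [folklore] -/
theorem detWeightEpsilon_iff_named : DetWeightEpsilon ↔
    (∀ (K : Type) [Field K] [NumberField K] (n : ℕ), 0 < n → ∀ (ℓ : ℕ) [Fact ℓ.Prime] (ι : PadicAlgCl ℓ ≃+* ℂ)
      (ρ : FramedGaloisRep K (PadicAlgCl ℓ) n), ρ.toGaloisRep.IsIrreducible →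
      ((∀ᶠ v : IsDedekindDomain.HeightOneSpectrum (NumberField.RingOfIntegers K) in cofinite, ρ.IsUnramifiedAt v) ∧ ∀ (v : IsDedekindDomain.HeightOneSpectrum (NumberField.RingOfIntegers K)) (hv : ((ℓ : ℕ) : NumberField.RingOfIntegers K) ∈ v.asIdeal), (Literature.NumberTheory.PAdicHodge.fontainePstAdicCompletion v ℓ hv).IsDeRhamFramed (ρ.toLocal v)) →
      HasDetWeight K ℓ ι ρ) :=
  ⟨fun h K _ _ n hn ℓ _ ι ρ hirr hgeo => h K n hn ℓ ι ρ hirr hgeo, fun h K _ _ n hn ℓ _ ι ρ hirr hgeo => h K n hn ℓ ι ρ hirr hgeo⟩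

/-- εPURE IS the named dial under the GWW binders (definitional). [folklore] -/
theorem epsilonPurity_iff_named : EpsilonPurity ↔
    (∀ (K : Type) [Field K] [NumberField K] (n : ℕ), 0 < n → ∀ (ℓ : ℕ) [Fact ℓ.Prime] (ι : PadicAlgCl ℓ ≃+* ℂ)
      (ρ : FramedGaloisRep K (PadicAlgCl ℓ) n), ρ.toGaloisRep.IsIrreducible →
      ((∀ᶠ v : IsDedekindDomain.HeightOneSpectrum (NumberField.RingOfIntegers K) in cofinite, ρ.IsUnramifiedAt v) ∧ ∀ (v : IsDedekindDomain.HeightOneSpectrum (NumberField.RingOfIntegers K)) (hv : ((ℓ : ℕ) : NumberField.RingOfIntegers K) ∈ v.asIdeal), (Literature.NumberTheory.PAdicHodge.fontainePstAdicCompletion v ℓ hv).IsDeRhamFramed (ρ.toLocal v)) →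
      IsEpsilonPure K ℓ ι ρ) :=
  ⟨fun h K _ _ n hn ℓ _ ι ρ hirr hgeo => h K n hn ℓ ι ρ hirr hgeo, fun h K _ _ n hn ℓ _ ι ρ hirr hgeo => h K n hn ℓ ι ρ hirr hgeo⟩

/-- **EXACTNESS of the EQUIV layer (kernel, mod NOTHING): `εPURE ↔ DWε ∧ SD`.** [folklore] -/
theorem epsilonPurity_iff_pieces : EpsilonPurity ↔ (DetWeightEpsilon ∧ SpreadDecay) := by
  constructor
  · intro h
    exact ⟨fun K _ _ n hn ℓ _ ι ρ hirr hgeo => hasDetWeight_of_isEpsilonPure ι hn (h K n hn ℓ ι ρ hirr hgeo),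
      fun K _ _ n hn ℓ _ ι ρ hirr hgeo => hasSpreadDecay_of_isEpsilonPure ι (h K n hn ℓ ι ρ hirr hgeo)⟩
  · rintro ⟨hD, hS⟩ K _ _ n hn ℓ _ ι ρ hirr hgeo
    exact isEpsilonPure_of_pieces ι hn (hD K n hn ℓ ι ρ hirr hgeo) (hS K n hn ℓ ι ρ hirr hgeo)

/-- DWε is WEAKER than εPURE. [folklore] -/
theorem detWeightEpsilon_of_epsilonPurity (h : EpsilonPurity) : DetWeightEpsilon := (epsilonPurity_iff_pieces.1 h).1

/-- SD is WEAKER than εPURE. [folklore] -/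
theorem spreadDecay_of_epsilonPurity (h : EpsilonPurity) : SpreadDecay := (epsilonPurity_iff_pieces.1 h).2

/-- **εPURE ⇒ GWW** (the target BY NAME; `ε := 1/2`). [folklore] -/
theorem gww_of_epsilonPurity (h : EpsilonPurity) : Summit.Langlands.Langlands.Theorems.SatakeWindowCarving.GaloisWeightWindow :=
  fun K _ _ n hn ℓ _ ι ρ hirr hgeo => hasWeightWindow_of_isEpsilonPure ι (h K n hn ℓ ι ρ hirr hgeo)

/-- **closes_gww** — the deciding seam of this layer-2 node: the two pieces give the target `GaloisWeightWindow` BY NAME (kernel). [folklore] -/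
theorem closes_gww (hD : DetWeightEpsilon) (hS : SpreadDecay) : Summit.Langlands.Langlands.Theorems.SatakeWindowCarving.GaloisWeightWindow :=
  gww_of_epsilonPurity (epsilonPurity_iff_pieces.2 ⟨hD, hS⟩)

/-- `ChildAssembly` holds (it is `closes_gww`). [folklore] -/
theorem childAssembly_holds : ChildAssembly := closes_gww

/-- **closes_host**: the pieces and the g30 residual WWA give the host crux `B_w` (stmt-Langlands-17414) BY NAME. [folklore] -/
theorem closes_host (hD : DetWeightEpsilon) (hS : SpreadDecay) (hW : Summit.Langlands.Langlands.Theorems.SatakeWindowCarving.WindowedWeakAutomorphy) :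
    Summit.Langlands.Langlands.Theses.PrimeSwitchSplit.WeakGeometricAutomorphy :=
  Summit.Langlands.Langlands.Theorems.SatakeWindowCarving.closes_child (closes_gww hD hS) hW

/-- **closes_root**: with the host route's other cruxes (W⁺ = `SatakeAvatarExistence` 17415, P = `PadicMemberCompatibility` 17534,
A = `CompatibilityAwayFromLR` 18084, R = `CanonicalReciprocityData` 17930) the pieces give `Langlands`. [folklore] -/
theorem closes_root (hD : DetWeightEpsilon) (hS : SpreadDecay) (hW : Summit.Langlands.Langlands.Theorems.SatakeWindowCarving.WindowedWeakAutomorphy)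
    (hWp : Summit.Langlands.Langlands.Theses.PrimeSwitchSplit.SatakeAvatarExistence)
    (hPm : Summit.Langlands.Langlands.Theses.PrimeSwitchSplit.PadicMemberCompatibility)
    (hA : Summit.Langlands.Langlands.Theses.PrimeSwitchSplit.CompatibilityAwayFromLR)
    (hR : Summit.Langlands.Langlands.Theses.PrimeSwitchSplit.CanonicalReciprocityData) : _root_.Langlands :=
  Summit.Langlands.Langlands.Theorems.SatakeWindowCarving.closes_root (closes_gww hD hS) hW hWp hPm hA hR

/-! ### Necessity -/

/-- the host crux `B_w` is S-implied (re-proved inline; = the private `target_of_langlands` of the g30 twin). [folklore] -/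
private theorem weakAut_of_langlands (hL : _root_.Langlands) : Summit.Langlands.Langlands.Theses.PrimeSwitchSplit.WeakGeometricAutomorphy := by
  intro K _ _ n hcpt hn ℓ _ ι ρ hirr hgeo
  obtain ⟨⟨Rec⟩, h⟩ := hL K
  obtain ⟨π, hπ, hcorr⟩ := (h Rec n hn hcpt).2 ℓ ι ρ hirr ⟨hgeo.1, fun v hv => hgeo.2 v hv⟩
  exact ⟨π, hπ, hcorr.1⟩

/-- **DWε IS S-IMPLIED, IN KERNEL**: `B_w → DWε`.  A weakly automorphic `ρ` has `∏β = ι⁻¹((∏ t_{π,v})⁻¹) = ι⁻¹(Ω(ϖ_v)⁻¹)`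
(`roots_arithFrobPolyOfSatake`; `centralCharacter_satake_of_cuspidal`: `Ω(ϖ_v) = det t_{π,v}`, Borel–Jacquet §5.7) and
`|Ω(ϖ_v)| = q_v^{-σ}` for ONE real `σ` (`HeckeCharacter.exists_norm_valueAtUniformizer_eq_rpow_neg`, Weil BNT VII §7), so
`|ι ∏β| = q_v^{σ}` EXACTLY: `w_d = 2σ`. [folklore] -/
theorem detWeight_of_weakAut (h : Summit.Langlands.Langlands.Theses.PrimeSwitchSplit.WeakGeometricAutomorphy) : DetWeightEpsilon := by
  intro K _ _ n hn ℓ _ ι ρ hirr hgeo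
  classical
  haveI : NeZero n := ⟨hn.ne'⟩
  have hcpt : isCompact_glFiniteIntegralLevel n K := isCompact_glFiniteIntegralLevel_holds n K
  obtain ⟨π, -, hcomp⟩ := h K n hcpt hn ℓ ι ρ hirr hgeo
  obtain ⟨Ω, hΩ⟩ := centralCharacter_satake_of_cuspidal π
  obtain ⟨σΩ, -, hnΩ⟩ := Ω.exists_norm_valueAtUniformizer_eq_rpow_neg
  refine ⟨2 * σΩ, fun ε hε => ?_⟩
  filter_upwards [hcomp, hΩ] with v hv hΩv Q hQ
  have hq1 : (1 : ℝ) < v.residueCard := by exact_mod_cast v.one_lt_residueCard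
  have hq0 : (0 : ℝ) < v.residueCard := zero_lt_one.trans hq1
  obtain ⟨α, hπα, -, hFrob⟩ := hv
  obtain ⟨𝔓, h𝔓⟩ := v.primesAbove_nonempty
  obtain ⟨τ, hτ⟩ := HeightOneSpectrum.exists_isArithFrobAt_of_mem_primesAbove_holds h𝔓
  have hQeq : Q = arithFrobPolyOfSatake ι v.residueCard 1 α := by rw [← hQ 𝔓 h𝔓 τ hτ, ← hFrob 𝔓 h𝔓 τ hτ]
  have hprod : ‖ι Q.roots.prod‖ = (v.residueCard : ℝ) ^ σΩ := by
    rw [hQeq, roots_arithFrobPolyOfSatake, map_multiset_prod, Multiset.map_map]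
    have hfun : ((ι : PadicAlgCl ℓ → ℂ) ∘ fun a : ℂ => ι.symm (((Real.sqrt (v.residueCard : ℕ) : ℝ) : ℂ) ^ (1 - 1) * a)⁻¹) = fun a : ℂ => a⁻¹ := by
      funext a
      simp
    rw [hfun, Multiset.prod_map_inv, Multiset.map_id', norm_inv, ← hΩv α hπα, hnΩ v, Real.rpow_neg hq0.le, inv_inv]
  rw [hprod]
  constructor
  · exact Real.rpow_le_rpow_of_exponent_le hq1.le (by linarith)
  · exact Real.rpow_le_rpow_of_exponent_le hq1.le (by linarith)

/-- DWε is S-implied (kernel). [folklore] -/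
theorem detWeight_of_langlands (hL : _root_.Langlands) : DetWeightEpsilon := detWeight_of_weakAut (weakAut_of_langlands hL)

/-- NECESSITY OF THE SPLIT modulo the print seam: granting TPN, the target gives both pieces. [folklore] -/
theorem pieces_of_gww (hT : TensorPowerNarrowing) (hG : Summit.Langlands.Langlands.Theorems.SatakeWindowCarving.GaloisWeightWindow) :
    DetWeightEpsilon ∧ SpreadDecay :=
  epsilonPurity_iff_pieces.1 (hT hG)

/-- EXACT mod TPN: `(DWε ∧ SD) ↔ GWW`. [folklore] -/
theorem pieces_iff_target_modTPN (hT : TensorPowerNarrowing) :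
    (DetWeightEpsilon ∧ SpreadDecay) ↔ Summit.Langlands.Langlands.Theorems.SatakeWindowCarving.GaloisWeightWindow :=
  ⟨fun h => closes_gww h.1 h.2, pieces_of_gww hT⟩

/-- both pieces are S-implied modulo TPN (DWε even in kernel, `detWeight_of_langlands`). [folklore] -/
theorem pieces_of_langlands (hT : TensorPowerNarrowing) (hL : _root_.Langlands) : DetWeightEpsilon ∧ SpreadDecay :=
  pieces_of_gww hT (Summit.Langlands.Langlands.Theorems.SatakeWindowCarving.gww_of_langlands hL)

/-- SD is S-implied modulo TPN. [folklore] -/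
theorem spreadDecay_of_langlands (hT : TensorPowerNarrowing) (hL : _root_.Langlands) : SpreadDecay := (pieces_of_langlands hT hL).2

end Kernel

/-! ## BC5 rungs (texts = a piece + ONE inserted hypothesis, or `n := 1`) and their S-cases -/

/-- rung of SD (PROVED, `projFiniteSpreadRung`): SD on PROJECTIVELY FINITE `ρ` — `∃ k > 0, ∀ σ, ρ(σ)^k` scalar — e.g. every twist of an
Artin representation by any character; there `B_w` contains the strong Artin conjecture (OPEN for insoluble images, n ≥ 2), while the
spread is decidable spectrum algebra. -/
def ProjFiniteSpreadRung : Prop :=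
  ∀ (K : Type) [Field K] [NumberField K] (n : ℕ), 0 < n → ∀ (ℓ : ℕ) [Fact ℓ.Prime] (ι : PadicAlgCl ℓ ≃+* ℂ) (ρ : Literature.NumberTheory.GaloisRepresentations.FramedGaloisRep K (PadicAlgCl ℓ) n), ρ.toGaloisRep.IsIrreducible → (∃ k : ℕ, 0 < k ∧ ∀ σ : Field.absoluteGaloisGroup K, ∃ c : PadicAlgCl ℓ, ((ρ σ : GL (Fin n) (PadicAlgCl ℓ)) : Matrix (Fin n) (Fin n) (PadicAlgCl ℓ)) ^ k = algebraMap (PadicAlgCl ℓ) (Matrix (Fin n) (Fin n) (PadicAlgCl ℓ)) c) → ((∀ᶠ v : IsDedekindDomain.HeightOneSpectrum (NumberField.RingOfIntegers K) in cofinite, ρ.IsUnramifiedAt v) ∧ ∀ (v : IsDedekindDomain.HeightOneSpectrum (NumberField.RingOfIntegers K)) (hv : ((ℓ : ℕ) : NumberField.RingOfIntegers K) ∈ v.asIdeal), (Literature.NumberTheory.PAdicHodge.fontainePstAdicCompletion v ℓ hv).IsDeRhamFramed (ρ.toLocal v)) → ∀ ε : ℝ, 0 < ε → ∀ᶠ v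 : IsDedekindDomain.HeightOneSpectrum (NumberField.RingOfIntegers K) in Filter.cofinite, ∀ P : Polynomial (PadicAlgCl ℓ), ρ.HasFrobCharpolyAt v P → ∀ β ∈ P.roots, ∀ β' ∈ P.roots, ‖ι β‖ ≤ (v.residueCard : ℝ) ^ ε * ‖ι β'‖

/-- rung of εPURE / DWε / SD (PROVED, `finiteOrderPurityRung`): ε-purity with `w = 0` on FINITE-ORDER `ρ` (Artin representations). -/
def FiniteOrderPurityRung : Prop :=
  ∀ (K : Type) [Field K] [NumberField K] (n : ℕ), 0 < n → ∀ (ℓ : ℕ) [Fact ℓ.Prime] (ι : PadicAlgCl ℓ ≃+* ℂ) (ρ : Literature.NumberTheory.GaloisRepresentations.FramedGaloisRep K (PadicAlgCl ℓ) n), ρ.toGaloisRep.IsIrreducible → (∃ k : ℕ, 0 < k ∧ ∀ σ : Field.absoluteGaloisGroup K, ρ σ ^ k = 1) → ((∀ᶠ v : IsDedekindDomain.HeightOneSpectrum (NumberField.RingOfIntegers K) in cofinite, ρ.IsUnramifiedAt v) ∧ ∀ (v : IsDedekindDomain.HeightOneSpectrum (NumberField.RingOfIntegers K)) (hv : ((ℓ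 : ℕ) : NumberField.RingOfIntegers K) ∈ v.asIdeal), (Literature.NumberTheory.PAdicHodge.fontainePstAdicCompletion v ℓ hv).IsDeRhamFramed (ρ.toLocal v)) → ∃ w : ℝ, ∀ ε : ℝ, 0 < ε → ∀ᶠ v : IsDedekindDomain.HeightOneSpectrum (NumberField.RingOfIntegers K) in Filter.cofinite, ∀ P : Polynomial (PadicAlgCl ℓ), ρ.HasFrobCharpolyAt v P → ∀ β ∈ P.roots, (v.residueCard : ℝ) ^ (w / 2 - ε) ≤ ‖ι β‖ ∧ ‖ι β‖ ≤ (v.residueCard : ℝ) ^ (w / 2 + ε)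

/-- rung of εPURE at `n = 1` (PROVED modulo the named tree fact `FramedGaloisRep.exists_heckeCharacter_of_isDeRhamFramed`,
`rankOnePurityRung_of_fact`): the GWW/εPURE text at `n := 1`. [conjecture] -/
def RankOnePurityRung : Prop :=
  ∀ (K : Type) [Field K] [NumberField K] (ℓ : ℕ) [Fact ℓ.Prime] (ι : PadicAlgCl ℓ ≃+* ℂ) (ρ : Literature.NumberTheory.GaloisRepresentations.FramedGaloisRep K (PadicAlgCl ℓ) 1), ρ.toGaloisRep.IsIrreducible → ((∀ᶠ v : IsDedekindDomain.HeightOneSpectrum (NumberField.RingOfIntegers K) in cofinite, ρ.IsUnramifiedAt v) ∧ ∀ (v : IsDedekindDomain.HeightOneSpectrum (NumberField.RingOfIntegers K)) (hv : ((ℓ : ℕ) : NumberField.RingOfIntegers K) ∈ v.asIdeal), (Literature.NumberTheory.PAdicHodge.fontainePstAdicCompletion v ℓ hv).IsDeRhamFramed (ρ.toLocal v)) → ∃ w : ℝ, ∀ ε : ℝ, 0 < ε → ∀ᶠ v : IsDedekindDomain.HeightOneSpectrum (NumberField.RingOfIntegers K) in Filter.cofinite, ∀ P : Polynomial (PadicAlgCl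 ℓ), ρ.HasFrobCharpolyAt v P → ∀ β ∈ P.roots, (v.residueCard : ℝ) ^ (w / 2 - ε) ≤ ‖ι β‖ ∧ ‖ι β‖ ≤ (v.residueCard : ℝ) ^ (w / 2 + ε)

/-- S-case of the rungs (t3): `B_w` RESTRICTED to projectively finite `ρ` — contains the strong Artin conjecture for every twist class
of Artin representations; NOT a theorem in the tree. [conjecture] -/
def ProjFiniteCase : Prop :=
  ∀ (K : Type) [Field K] [NumberField K] (n : ℕ) (hcpt : Literature.NumberTheory.Automorphic.isCompact_glFiniteIntegralLevel n K), 0 < n → ∀ (ℓ : ℕ) [Fact ℓ.Prime] (ι : PadicAlgCl ℓ ≃+* ℂ) (ρ : Literature.NumberTheory.GaloisRepresentations.FramedGaloisRep K (PadicAlgCl ℓ) n), ρ.toGaloisRep.IsIrreducible → (∃ k : ℕ, 0 < k ∧ ∀ σ : Field.absoluteGaloisGroup K, ∃ c : PadicAlgCl ℓ, ((ρ σ : GL (Fin n) (PadicAlgCl ℓ)) : Matrix (Fin n) (Fin n) (PadicAlgCl ℓ)) ^ k = algebraMap (PadicAlgCl ℓ) (Matrix (Fin n) (Fin n) (PadicAlgCl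 ℓ)) c) → ((∀ᶠ v : IsDedekindDomain.HeightOneSpectrum (NumberField.RingOfIntegers K) in cofinite, ρ.IsUnramifiedAt v) ∧ ∀ (v : IsDedekindDomain.HeightOneSpectrum (NumberField.RingOfIntegers K)) (hv : ((ℓ : ℕ) : NumberField.RingOfIntegers K) ∈ v.asIdeal), (Literature.NumberTheory.PAdicHodge.fontainePstAdicCompletion v ℓ hv).IsDeRhamFramed (ρ.toLocal v)) → ∃ π : Literature.NumberTheory.Automorphic.CuspidalAutomorphicRepData n K hcpt, π.1.IsLAlgebraic ∧ ∀ᶠ v : IsDedekindDomain.HeightOneSpectrum (NumberField.RingOfIntegers K) in cofinite, SatakeFrobCompatibleAt ι π.1 ρ v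

/-- S-case of the finite-order rung (t3): `B_w` on finite-order `ρ` = the strong Artin conjecture in the summit's typing; NOT a theorem
in the tree (OPEN for insoluble images). [conjecture] -/
def ArtinCase : Prop :=
  ∀ (K : Type) [Field K] [NumberField K] (n : ℕ) (hcpt : Literature.NumberTheory.Automorphic.isCompact_glFiniteIntegralLevel n K), 0 < n → ∀ (ℓ : ℕ) [Fact ℓ.Prime] (ι : PadicAlgCl ℓ ≃+* ℂ) (ρ : Literature.NumberTheory.GaloisRepresentations.FramedGaloisRep K (PadicAlgCl ℓ) n), ρ.toGaloisRep.IsIrreducible → (∃ k : ℕ, 0 < k ∧ ∀ σ : Field.absoluteGaloisGroup K, ρ σ ^ k = 1) → ((∀ᶠ v : IsDedekindDomain.HeightOneSpectrum (NumberField.RingOfIntegers K) in cofinite, ρ.IsUnramifiedAt v) ∧ ∀ (v : IsDedekindDomain.HeightOneSpectrum (NumberField.RingOfIntegers K)) (hv : ((ℓ : ℕ) : NumberField.RingOfIntegers K) ∈ v.asIdeal), (Literature.NumberTheory.PAdicHodge.fontainePstAdicCompletion v ℓ hv).IsDeRhamFramed (ρ.toLocal v)) → ∃ π : Literature.NumberTheory.Automorphic.CuspidalAutomorphicRepData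 n K hcpt, π.1.IsLAlgebraic ∧ ∀ᶠ v : IsDedekindDomain.HeightOneSpectrum (NumberField.RingOfIntegers K) in cofinite, SatakeFrobCompatibleAt ι π.1 ρ v

section Rungs

open IsDedekindDomain NumberField Literature.NumberTheory.GaloisRepresentations

/-- the projectively-finite rung is a restriction of SD. [folklore] -/
theorem projFiniteSpreadRung_of_spreadDecay (h : SpreadDecay) : ProjFiniteSpreadRung :=
  fun K _ _ n hn ℓ _ ι ρ hirr _ hgeo => h K n hn ℓ ι ρ hirr hgeo

/-- **the projectively-finite rung HOLDS** (kernel). [folklore] -/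
theorem projFiniteSpreadRung : ProjFiniteSpreadRung :=
  fun K _ _ n hn ℓ _ ι ρ _ hpf _ => by
    obtain ⟨k, hk, hρ⟩ := hpf
    exact hasSpreadDecay_of_projFinite ι ρ hk hρ

/-- the finite-order rung is a restriction of εPURE. [folklore] -/
theorem finiteOrderPurityRung_of_epsilonPurity (h : EpsilonPurity) : FiniteOrderPurityRung :=
  fun K _ _ n hn ℓ _ ι ρ hirr _ hgeo => h K n hn ℓ ι ρ hirr hgeo

/-- **the finite-order rung HOLDS** (kernel). [folklore] -/
theorem finiteOrderPurityRung : FiniteOrderPurityRung :=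
  fun K _ _ n hn ℓ _ ι ρ _ hfin _ => by
    obtain ⟨k, hk, hρ⟩ := hfin
    exact isEpsilonPure_of_finiteOrder ι ρ hk hρ

/-- the rank-one rung is a restriction of εPURE. [folklore] -/
theorem rankOnePurityRung_of_epsilonPurity (h : EpsilonPurity) : RankOnePurityRung :=
  fun K _ _ ℓ _ ι ρ hirr hgeo => h K 1 Nat.one_pos ℓ ι ρ hirr hgeo

/-- **the rank-one rung HOLDS modulo the named fact** `exists_heckeCharacter_of_isDeRhamFramed`. [folklore] -/
theorem rankOnePurityRung_of_fact (hF : DeRhamCharacterHeckeAvatar) : RankOnePurityRung :=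
  fun _ _ _ _ _ ι ρ _ hgeo => isEpsilonPure_rankOne_of_fact hF ι ρ hgeo.2

/-- **the g30 plan-only rung `RankOneWindowRung` (GWW at `n = 1`) HOLDS modulo the same named fact** — it closes `stub_rankOne` of the
queued child route `SatakeWindowCarving` up to `exists_heckeCharacter_of_isDeRhamFramed`. [folklore] -/
theorem rankOneWindowRung_of_fact (hF : DeRhamCharacterHeckeAvatar) :
    Summit.Langlands.Langlands.Theorems.SatakeWindowCarving.RankOneWindowRung :=
  fun _ _ _ _ _ ι ρ _ hgeo => hasWeightWindow_of_isEpsilonPure ι (isEpsilonPure_rankOne_of_fact hF ι ρ hgeo.2)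

/-- the S-case of the finite-order rung is a restriction of `B_w`. [folklore] -/
theorem artinCase_of_weakAut (h : Summit.Langlands.Langlands.Theses.PrimeSwitchSplit.WeakGeometricAutomorphy) : ArtinCase :=
  fun K _ _ n hcpt hn ℓ _ ι ρ hirr _ hgeo => h K n hcpt hn ℓ ι ρ hirr hgeo

/-- the S-case of the projectively-finite rung is a restriction of `B_w`. [folklore] -/
theorem projFiniteCase_of_weakAut (h : Summit.Langlands.Langlands.Theses.PrimeSwitchSplit.WeakGeometricAutomorphy) : ProjFiniteCase :=
  fun K _ _ n hcpt hn ℓ _ ι ρ hirr _ hgeo => h K n hcpt hn ℓ ι ρ hirr hgeo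

end Rungs


end Summit.Langlands.Langlands.Theorems.SpreadDecayCarving
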